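import Summits.PneNP.PneNP.Theses.Mobius
import Literature.NumberTheory.LFunctions.LiouvilleNonpretentious

/-!
# Route Mobius — `PretentiousGlue` (stmt-PneNP-1115)

`AC0MultiplicativePretentious → LiouvilleNotAC0`: the Liouville function is a monoid hom `ℕ →* ℤ` with `λ(p) = −1` on
primes, its language is `L_λ`, and `(n ↦ (λ n : ℂ))` is non-pretentious by the PROVED tree theorem
`Literature.NumberTheory.LFunctions.isNonpretentious_liouville_holds`; so `L_λ ∈ AC⁰` would contradict the crux.
-/

set_option linter.dupNamespace false -- `Summit.PneNP.PneNP.…`: summit = sub-problem name (D-0017 single-conjunct layout)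

namespace Summit.PneNP.PneNP.Theorems

open ArithmeticFunction

/-- **Support item `PretentiousGlue` of route Mobius (stmt-PneNP-1115)**: `AC0MultiplicativePretentious → LiouvilleNotAC0`,
instantiating the crux at the completely multiplicative `λ : ℕ →* ℤ` (`λ(p) = −1`) and the proved non-pretentiousness of
`λ`. [cite: Tao2015, §1 (1.12)] [folklore] -/
theorem mobius_pretentiousGlue_proof : Summit.PneNP.PneNP.Theses.Mobius.PretentiousGlue := by
  unfold Summit.PneNP.PneNP.Theses.Mobius.PretentiousGlue Summit.PneNP.PneNP.Theses.Mobius.AC0MultiplicativePretentious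
    Summit.PneNP.PneNP.Theses.Mobius.LiouvilleNotAC0
  intro hP hAC0
  let f : ℕ →* ℤ :=
    { toFun := fun n => liouville n
      map_one' := liouville_apply_one
      map_mul' := liouville_apply_mul }
  have hprime : ∀ p : ℕ, p.Prime → f p = 1 ∨ f p = -1 := fun p hp => Or.inr (by
    show liouville p = -1
    rw [liouville_apply hp.ne_zero, cardFactors_apply_prime hp, pow_one])
  exact hP f hprime hAC0 Literature.NumberTheory.LFunctions.isNonpretentious_liouville_holds

end Summit.PneNP.PneNP.Theorems
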